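import Literature.AlgebraicGeometry.Resolution.EffectiveCartierStalks
import Literature.AlgebraicGeometry.Resolution.RegularLocalRingsUFD
import Literature.AlgebraicGeometry.Resolution.CoefficientIdealRestriction
import Literature.AlgebraicGeometry.Resolution.MonomialMarkedIdealsBlowup
import Literature.AlgebraicGeometry.Resolution.MonomialOrderReductionUnit
import Mathlib.RingTheory.KrullDimension.Regular
import HarnessLib

/-!
# [OURS · L1 W4.5(b) · EL♮(3)] HSUB′(ReachTower₁) inner chain — «THE CARRIER CUTS AN EFFECTIVE CARTIER DIVISOR ON THE CONE» (clause
# (viii) of `TCPlus.MemberKC`, res-D-pv-029 p554345) THROUGH A REGULAR POINT STEP: the ring and stalk lemmas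
# (crux `EquisingularLiftNatThree` = stmt-ResolutionOfSingularities-20148, parent `EquisingularLiftNat` = stmt-…-20038)

HONEST FRAMING. OURS (cell res-hironaka, crux chain w45b, slot W4.5(b)); NOT a statement of any manuscript; AI-written, weaker than expert
review. Helper `--supports stmt-ResolutionOfSingularities-20148 --as helper`; closes nothing; no `sorry`; standard axioms; DEF-FREE.
res-L1-w45b-stub-4, for the `…KC` twins of (A) p541999 / (B) p543848 (res-D-pv-029 g8 (S2) ASK and 2026-08-27T18:22:04Z currency
`TCPlus.MemberKC`/`InvKC`): `IsEffectiveCartier (𝓢.comap K.subschemeι)` is read stalkwise as the POINTWISE CARTIER DATUM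
«`K_z = (f)`, `𝓢_z = (h)`, `h̄` a non-zero-divisor of `𝒪_{X,z}/(f)`», which (1) is produced at a closed point of a regular stage by
UNIQUE FACTORISATION (Auslander–Buchsbaum, tree `IsRegularLocalRing.uniqueFactorizationMonoid`) from «`𝒪_{X,z}/(f, h)` has codimension
2» (clause (v)), (2) passes through a blow-up at points OFF its centre (stalk isomorphism), (3) reassembles to `IsEffectiveCartier` on a
quasi-compact stage from the CLOSED points alone (the Cartier locus is open, Literature `EffectiveCartierStalks`; an open set of a compact
Kolmogorov space containing every closed point is everything).

* `mk_mem_nonZeroDivisors_of_no_prime_factors` — UFD: `f ≠ 0`, no prime divides both `f` and `h` ⇒ `h̄ ∈ (R/(f))⁰`.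
* `no_prime_factors_of_ringKrullDim_quotient`, `ne_zero_of_ringKrullDim_quotient` — Noetherian local domain of dimension `n + 2`:
  `dim R/(h, f) + 2 = dim R` ⇒ `f ≠ 0` and no prime divides both (else `R/(h,f) ↠ R/(d)`, `dim R/(d) = dim R − 1`, Krull).
* `cartierDatum_of_codimTwo` — the datum at a closed point of a regular local ring of dimension `n + 2` from codimension 2.
* `mem_cartierLocus_subschemeι_of_datum` / `datum_of_mem_cartierLocus_subschemeι` — datum ⟺ Cartier locus of `𝓢.comap ι_K`
  (`ι_K^♯` onto with kernel `K_z`).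
* `datum_strictTransform_of_not_mem_support` — transport along a blow-up off its centre (`St = total`, `τ^♯` iso).
* `isEffectiveCartier_comap_subschemeι_of_forall_isClosed` — (3).

References: H. Matsumura, *Commutative Ring Theory* (1986), Thm. 20.3, Thm. 14.2; The Stacks Project, Tags 01WR–01WS, 00KW, 02OS — through the
cited tree files. OURS planning texts (index only): res-D-pv-029 STATUS 2026-08-27T18:22:04Z, 18:25:10Z; res-L1-w45b-stub-4 18:25:01Z.
-/

set_option linter.dupNamespace false -- mandated namespace `Summit.<Summit>.<Problem>` of this single-conjunct summit

noncomputable section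

open CategoryTheory CategoryTheory.Limits AlgebraicGeometry TopologicalSpace Topology IsLocalRing
open Literature.AlgebraicGeometry.Resolution
open AlgebraicGeometry.Scheme.IdealSheafData
open scoped nonZeroDivisors

namespace Summit.ResolutionOfSingularities.ResolutionOfSingularities.Cruxes.EquisingularLiftNat.Sections

/-! ## Ring lemmas -/

section Ring

variable {R : Type*} [CommRing R]

/-- **UFD: coprime ⇒ non-zero-divisor modulo.** If `f ≠ 0` and no prime divides both `f` and `h`, then the class of `h` is a
non-zero-divisor of `R/(f)`. [cite: Matsumura1987, Thm. 20.3] [folklore] -/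
theorem mk_mem_nonZeroDivisors_of_no_prime_factors [IsDomain R] [UniqueFactorizationMonoid R] {f h : R} (hf : f ≠ 0)
    (H : ∀ ⦃d : R⦄, d ∣ f → d ∣ h → ¬ Prime d) :
    Ideal.Quotient.mk (Ideal.span {f}) h ∈ (R ⧸ Ideal.span {f})⁰ := by
  rw [mem_nonZeroDivisors_iff_right]
  intro x hx
  obtain ⟨a, rfl⟩ := Ideal.Quotient.mk_surjective x
  rw [← map_mul, Ideal.Quotient.eq_zero_iff_mem, Ideal.mem_span_singleton] at hx
  rw [Ideal.Quotient.eq_zero_iff_mem, Ideal.mem_span_singleton]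
  exact UniqueFactorizationMonoid.dvd_of_dvd_mul_left_of_no_prime_factors hf H hx

/-- `WithBot ℕ∞` bookkeeping: `a + k = m + k` with natural `m, k` forces `a = m`. [folklore] -/
theorem withBotENat_eq_of_add_natCast_eq (a : WithBot ℕ∞) (m k : ℕ)
    (h : a + (k : WithBot ℕ∞) = ((m + k : ℕ) : WithBot ℕ∞)) : a = (m : WithBot ℕ∞) := by
  induction a using WithBot.recBotCoe with
  | bot =>
    exfalso
    rw [WithBot.bot_add, ← WithBot.coe_natCast] at h
    exact WithBot.bot_ne_coe h
  | coe a =>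
    induction a using ENat.recTopCoe with
    | top =>
      exfalso
      rw [← WithBot.coe_natCast k, ← WithBot.coe_natCast (m + k), ← WithBot.coe_add, WithBot.coe_eq_coe, top_add] at h
      exact ENat.top_ne_coe _ h
    | coe a =>
      rw [← WithBot.coe_natCast k, ← WithBot.coe_natCast (m + k), ← WithBot.coe_add, WithBot.coe_eq_coe] at h
      have : a + k = m + k := by exact_mod_cast h
      have ha : a = m := by omega
      subst ha
      exact WithBot.coe_natCast a

variable [IsDomain R] [IsLocalRing R] [IsNoetherianRing R]

/-- **Codimension two leaves no room for a common prime factor**: in a Noetherian local domain of dimension `n + 2`, if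
`dim R/(h, f) + 2 = dim R` then no prime divides both `f` and `h` (else `R/(h,f) ↠ R/(d)` with `dim R/(d) + 1 = dim R`, Krull's
principal ideal theorem). [cite: StacksProject, Tag 00KW] [folklore] -/
theorem no_prime_factors_of_ringKrullDim_quotient {f h : R} {n : ℕ} (hR : ringKrullDim R = ((n + 2 : ℕ) : WithBot ℕ∞))
    (hdim : ringKrullDim (R ⧸ (Ideal.span {h} ⊔ Ideal.span {f})) + 2 = ringKrullDim R) :
    ∀ ⦃d : R⦄, d ∣ f → d ∣ h → ¬ Prime d := by
  intro d hdf hdh hd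
  have hdm : d ∈ maximalIdeal R := (IsLocalRing.mem_maximalIdeal _).mpr hd.not_unit
  have h1 : ringKrullDim (R ⧸ Ideal.span {d}) + 1 = ringKrullDim R :=
    ringKrullDim_quotient_span_singleton_succ_eq_ringKrullDim_of_mem_nonZeroDivisors
      (mem_nonZeroDivisors_of_ne_zero hd.ne_zero) hdm
  have hle : Ideal.span {h} ⊔ Ideal.span {f} ≤ Ideal.span {d} :=
    sup_le (Ideal.span_singleton_le_span_singleton.mpr hdh) (Ideal.span_singleton_le_span_singleton.mpr hdf)
  have h2 : ringKrullDim (R ⧸ Ideal.span {d}) ≤ ringKrullDim (R ⧸ (Ideal.span {h} ⊔ Ideal.span {f})) :=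
    ringKrullDim_le_of_surjective (Ideal.Quotient.factor hle) (Ideal.Quotient.factor_surjective hle)
  rw [hR] at h1 hdim
  have e1 := withBotENat_eq_of_add_natCast_eq _ (n + 1) 1 (by simpa only [Nat.cast_one] using h1)
  have e2 := withBotENat_eq_of_add_natCast_eq _ n 2 (by simpa only [Nat.cast_ofNat] using hdim)
  rw [e1, e2] at h2
  have : n + 1 ≤ n := by exact_mod_cast h2
  omega

/-- In the same situation `f ≠ 0`. [folklore] -/
theorem ne_zero_of_ringKrullDim_quotient {f h : R} {n : ℕ} (hR : ringKrullDim R = ((n + 2 : ℕ) : WithBot ℕ∞))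
    (hdim : ringKrullDim (R ⧸ (Ideal.span {h} ⊔ Ideal.span {f})) + 2 = ringKrullDim R) : f ≠ 0 := by
  rintro rfl
  rw [Ideal.span_singleton_zero, sup_bot_eq] at hdim   -- `span {0} = ⊥`? name: Ideal.span_singleton_zero? else `Ideal.span_zero`
  rw [hR] at hdim
  by_cases hh : h = 0
  · subst hh
    rw [Ideal.span_singleton_zero] at hdim
    have e := (ringKrullDim_eq_of_ringEquiv (RingEquiv.quotientBot R)).symm
    rw [← e, hR] at hdim
    have := withBotENat_eq_of_add_natCast_eq _ n 2 (by simpa only [Nat.cast_ofNat] using hdim)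
    have : n + 2 = n := by exact_mod_cast this
    omega
  · have hhm : h ∈ maximalIdeal R := by
      by_contra hu
      have hunit : IsUnit h := by rwa [IsLocalRing.mem_maximalIdeal, mem_nonunits_iff, not_not] at hu
      rw [Ideal.span_singleton_eq_top.mpr hunit] at hdim
      have e := ringKrullDim_eq_bot_of_subsingleton (R := R ⧸ (⊤ : Ideal R))
      rw [e, WithBot.bot_add, ← WithBot.coe_natCast] at hdim
      exact WithBot.bot_ne_coe hdim
    have h1 : ringKrullDim (R ⧸ Ideal.span {h}) + 1 = ((n + 2 : ℕ) : WithBot ℕ∞) := by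
      rw [← hR]
      exact ringKrullDim_quotient_span_singleton_succ_eq_ringKrullDim_of_mem_nonZeroDivisors
        (mem_nonZeroDivisors_of_ne_zero hh) hhm
    have e1 := withBotENat_eq_of_add_natCast_eq _ (n + 1) 1 (by simpa only [Nat.cast_one] using h1)
    rw [e1] at hdim
    have : n + 1 + 2 = n + 2 := by exact_mod_cast hdim
    omega

end Ring

/-- **The pointwise Cartier datum at a closed point of a regular stage from codimension two**: `R` regular local of dimension
`n + 2`, `I = (f)`, `J = (h)`, `R/(J ⊔ I)` of dimension `n` ⇒ `f ≠ 0` and `h̄ ∈ (R/(f))⁰`. [cite: Matsumura1987, Thm. 20.3]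
[cite: StacksProject, Tag 00KW] [OURS · L1 W4.5b] -/
theorem cartierDatum_of_codimTwo {R : Type*} [CommRing R] [IsRegularLocalRing R] {f h : R} {n : ℕ}
    (hR : ringKrullDim R = ((n + 2 : ℕ) : WithBot ℕ∞))
    (hdim : ringKrullDim (R ⧸ (Ideal.span {h} ⊔ Ideal.span {f})) + 2 = ringKrullDim R) :
    Ideal.Quotient.mk (Ideal.span {f}) h ∈ (R ⧸ Ideal.span {f})⁰ := by
  haveI := isDomain_of_isRegularLocalRing R
  haveI : UniqueFactorizationMonoid R := IsRegularLocalRing.uniqueFactorizationMonoid R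
  exact mk_mem_nonZeroDivisors_of_no_prime_factors (ne_zero_of_ringKrullDim_quotient hR hdim)
    (no_prime_factors_of_ringKrullDim_quotient hR hdim)

/-! ## The datum and the Cartier locus of `𝓢.comap ι_K` -/

section Locus

variable {X : Scheme.{0}} (𝓢 K : X.IdealSheafData)

/-- **Datum ⇒ Cartier locus.** If `K_z = (f)`, `𝓢_z = (h)` and `h̄ ∈ (𝒪_{X,z}/(f))⁰` at `z = ι_K w`, then `w` lies in the Cartier locus
of `𝓢.comap ι_K` (`ι_K^♯` is onto with kernel `K_z`). [cite: StacksProject, Tag 01WS] [folklore] -/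
theorem mem_cartierLocus_subschemeι_of_datum (w : ↥K.subscheme) (f h : X.presheaf.stalk (K.subschemeι w))
    (hf : stalkIdeal K (K.subschemeι w) = Ideal.span {f}) (hh : stalkIdeal 𝓢 (K.subschemeι w) = Ideal.span {h})
    (hnzd : Ideal.Quotient.mk (Ideal.span {f}) h ∈ (X.presheaf.stalk (K.subschemeι w) ⧸ Ideal.span {f})⁰) :
    w ∈ cartierLocus (𝓢.comap K.subschemeι) := by
  set π := (K.subschemeι.stalkMap w).hom with hπ
  have hker : RingHom.ker π = Ideal.span {f} := by rw [hπ, ker_stalkMap_subschemeι, hf]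
  have hsurj : Function.Surjective π := K.subschemeι.stalkMap_surjective w
  refine ⟨π h, ?_, ?_⟩
  · rw [mem_nonZeroDivisors_iff_right]
    intro x hx
    obtain ⟨a, rfl⟩ := hsurj x
    have h1 : a * h ∈ RingHom.ker π := by rw [RingHom.mem_ker, map_mul, hx]
    rw [hker] at h1
    have h2 : Ideal.Quotient.mk (Ideal.span {f}) a * Ideal.Quotient.mk (Ideal.span {f}) h = 0 := by
      rw [← map_mul, Ideal.Quotient.eq_zero_iff_mem]; exact h1
    have h3 := (mem_nonZeroDivisors_iff_right.mp hnzd) _ h2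
    rw [Ideal.Quotient.eq_zero_iff_mem, ← hker, RingHom.mem_ker] at h3
    exact h3
  · rw [stalkIdeal_comap_eq_map_stalkMap, hh, Ideal.map_span, Set.image_singleton]

/-- **Cartier locus ⇒ datum** (with principal stalks): conversely, if `w` lies in the Cartier locus of `𝓢.comap ι_K`, `ι_K w = z`,
and `K_z`, `𝓢_z` are principal, the datum holds for ANY generators `f`, `h`. [cite: StacksProject, Tag 01WS] [folklore] -/
theorem datum_of_mem_cartierLocus_subschemeι (w : ↥K.subscheme) {z : X} (hwz : K.subschemeι w = z)
    (hw : w ∈ cartierLocus (𝓢.comap K.subschemeι)) (f h : X.presheaf.stalk z)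
    (hf : stalkIdeal K z = Ideal.span {f}) (hh : stalkIdeal 𝓢 z = Ideal.span {h}) :
    Ideal.Quotient.mk (Ideal.span {f}) h ∈ (X.presheaf.stalk z ⧸ Ideal.span {f})⁰ := by
  subst hwz
  set π := (K.subschemeι.stalkMap w).hom with hπ
  have hker : RingHom.ker π = Ideal.span {f} := by rw [hπ, ker_stalkMap_subschemeι, hf]
  obtain ⟨g, hg, hI⟩ := hw
  have hI' : Ideal.span {g} = Ideal.span {π h} := by
    rw [← hI, stalkIdeal_comap_eq_map_stalkMap, hh, Ideal.map_span, Set.image_singleton]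
  -- `g = v · π h`, so `π h` is a non-zero-divisor as `g` is
  obtain ⟨v, hv⟩ : ∃ v, v * π h = g := by
    have : g ∈ Ideal.span {π h} := hI' ▸ Ideal.mem_span_singleton_self g
    exact Ideal.mem_span_singleton'.mp this
  have hπh : π h ∈ (K.subscheme.presheaf.stalk w)⁰ := by
    rw [mem_nonZeroDivisors_iff_right]
    intro x hx
    apply (mem_nonZeroDivisors_iff_right.mp hg) x
    rw [← hv, ← mul_assoc, mul_comm x v, mul_assoc, hx, mul_zero]
  rw [mem_nonZeroDivisors_iff_right]
  intro x hx
  obtain ⟨a, rfl⟩ := Ideal.Quotient.mk_surjective x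
  rw [← map_mul, Ideal.Quotient.eq_zero_iff_mem, ← hker, RingHom.mem_ker, map_mul] at hx
  have h3 := (mem_nonZeroDivisors_iff_right.mp hπh) _ hx
  rw [Ideal.Quotient.eq_zero_iff_mem, ← hker, RingHom.mem_ker]
  exact h3

end Locus

/-- The only closed point of `Spec` of a local ring is its closed point. [folklore] -/
theorem eq_closedPoint_of_isClosed_singleton {O : Type} [CommRing O] [IsLocalRing O] {p : ↥(Spec (.of O))}
    (hp : IsClosed ({p} : Set ↥(Spec (.of O)))) : p = IsLocalRing.closedPoint O := by
  have hmax : p.asIdeal.IsMaximal := (PrimeSpectrum.isClosed_singleton_iff_isMaximal p).mp hp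
  exact PrimeSpectrum.ext (IsLocalRing.eq_maximalIdeal hmax)

/-- A point of the support has its stalk ideal inside `𝔪`; two such principal stalk ideals sum to a proper ideal, so the point lies in the
support of the sum. [folklore] -/
theorem mem_support_sup_of_mem {X : Scheme.{0}} (I J : X.IdealSheafData) {z : X} (hI : z ∈ (I.support : Set X))
    (hJ : z ∈ (J.support : Set X)) : z ∈ ((I ⊔ J).support : Set X) := by
  have h1 := (mem_support_iff_stalkIdeal_le I z).mp hI
  have h2 := (mem_support_iff_stalkIdeal_le J z).mp hJ
  exact (mem_support_iff_stalkIdeal_le (I ⊔ J) z).mpr (by rw [stalkIdeal_sup]; exact sup_le h1 h2)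


/-! ## Transport of the datum along a blow-up, off its centre -/

/-- **Off the centre a blow-up carries the datum**: for a blow-up `τ` along `C`, a point `z` with `τ z ∉ V(C)`, and the datum for
`(𝓢, K)` at `τ z` with generators `f, h`: the datum for `(St 𝓢, St K)` at `z` with generators `τ^♯ f, τ^♯ h` (`St = total` off the centre,
`τ^♯` an isomorphism). [cite: StacksProject, Tag 02OS] [OURS · L1 W4.5b] -/
theorem datum_strictTransform_of_not_mem_support {X X' : Scheme.{0}} [IsLocallyNoetherian X'] {τ : X' ⟶ X} {C : X.IdealSheafData}
    (hτ : IsBlowup τ C) (𝓢 K : X.IdealSheafData) {z : X'} (hz : τ z ∉ C.support) (f h : X.presheaf.stalk (τ z))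
    (hf : stalkIdeal K (τ z) = Ideal.span {f}) (hh : stalkIdeal 𝓢 (τ z) = Ideal.span {h})
    (hnzd : Ideal.Quotient.mk (Ideal.span {f}) h ∈ (X.presheaf.stalk (τ z) ⧸ Ideal.span {f})⁰) :
    stalkIdeal (strictTransformIdeal τ C K) z = Ideal.span {(τ.stalkMap z).hom f} ∧
    stalkIdeal (strictTransformIdeal τ C 𝓢) z = Ideal.span {(τ.stalkMap z).hom h} ∧
    Ideal.Quotient.mk (Ideal.span {(τ.stalkMap z).hom f}) ((τ.stalkMap z).hom h) ∈
      (X'.presheaf.stalk z ⧸ Ideal.span {(τ.stalkMap z).hom f})⁰ := by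
  haveI : IsIso (τ.stalkMap z) := hτ.isIso_stalkMap_of_not_mem_support hz
  set φ := (τ.stalkMap z).hom with hφ
  have hK' : stalkIdeal (strictTransformIdeal τ C K) z = Ideal.span {φ f} := by
    rw [stalkIdeal_strictTransformIdeal_of_not_mem_support C K hz, hf, Ideal.map_span, Set.image_singleton]
  have h𝓢' : stalkIdeal (strictTransformIdeal τ C 𝓢) z = Ideal.span {φ h} := by
    rw [stalkIdeal_strictTransformIdeal_of_not_mem_support C 𝓢 hz, hh, Ideal.map_span, Set.image_singleton]
  refine ⟨hK', h𝓢', ?_⟩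
  -- the induced isomorphism of quotients
  let e : X.presheaf.stalk (τ z) ≃+* X'.presheaf.stalk z := (asIso (τ.stalkMap z)).commRingCatIsoToRingEquiv
  have he : ∀ a, e a = φ a := fun _ => rfl
  have hmap : Ideal.map (e : X.presheaf.stalk (τ z) →+* X'.presheaf.stalk z) (Ideal.span {f}) = Ideal.span {φ f} := by
    rw [Ideal.map_span, Set.image_singleton]; rfl
  let ē : (X.presheaf.stalk (τ z) ⧸ Ideal.span {f}) ≃+* (X'.presheaf.stalk z ⧸ Ideal.span {φ f}) :=
    Ideal.quotientEquiv (Ideal.span {f}) (Ideal.span {φ f}) e hmap.symm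
  have hē : ē (Ideal.Quotient.mk (Ideal.span {f}) h) = Ideal.Quotient.mk (Ideal.span {φ f}) (φ h) :=
    Ideal.quotientEquiv_mk _ _ _ _ h
  rw [← hē, mem_nonZeroDivisors_iff_right]
  intro x hx
  obtain ⟨y, rfl⟩ := ē.surjective x
  rw [← map_mul, map_eq_zero_iff ē ē.injective] at hx
  rw [(mem_nonZeroDivisors_iff_right.mp hnzd) y hx, map_zero]

/-! ## From the closed points to `IsEffectiveCartier` -/

/-- In a compact Kolmogorov space an open set containing every closed point is everything. [folklore] -/
theorem eq_univ_of_isOpen_of_forall_isClosed {α : Type*} [TopologicalSpace α] [CompactSpace α] [T0Space α] {U : Set α}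
    (hU : IsOpen U) (h : ∀ x : α, IsClosed ({x} : Set α) → x ∈ U) : U = Set.univ := by
  by_contra hne
  have hC : (Uᶜ).Nonempty := Set.nonempty_compl.mpr hne
  obtain ⟨x, hx, hxc⟩ := hU.isClosed_compl.exists_closed_singleton hC
  exact hx (h x hxc)

/-- **(viii) from the closed points.** On a locally Noetherian quasi-compact scheme: if at every CLOSED point `z` of `V(K) ∩ supp 𝓢` the
Cartier datum holds (`K_z = (f)`, `𝓢_z = (h)`, `h̄ ∈ (𝒪_{X,z}/(f))⁰`), then `𝓢.comap ι_K` is an effective Cartier divisor on `V(K)` (the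
Cartier locus is open and contains every closed point of the compact Kolmogorov space `V(K)`). [cite: StacksProject, Tag 01WS] [OURS · L1 W4.5b] -/
theorem isEffectiveCartier_comap_subschemeι_of_forall_isClosed {X : Scheme.{0}} [IsLocallyNoetherian X] [CompactSpace X]
    (𝓢 K : X.IdealSheafData)
    (h : ∀ z : X, IsClosed ({z} : Set X) → z ∈ (K.support : Set X) → z ∈ (𝓢.support : Set X) →
      ∃ f h : X.presheaf.stalk z, stalkIdeal K z = Ideal.span {f} ∧ stalkIdeal 𝓢 z = Ideal.span {h} ∧
        Ideal.Quotient.mk (Ideal.span {f}) h ∈ (X.presheaf.stalk z ⧸ Ideal.span {f})⁰) :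
    IsEffectiveCartier (𝓢.comap K.subschemeι) := by
  haveI : IsLocallyNoetherian K.subscheme := LocallyOfFiniteType.isLocallyNoetherian K.subschemeι
  haveI : CompactSpace ↥K.subscheme := K.subschemeι.isClosedEmbedding.compactSpace
  rw [isEffectiveCartier_iff_forall_mem_cartierLocus]
  have hall := eq_univ_of_isOpen_of_forall_isClosed (isOpen_cartierLocus (𝓢.comap K.subschemeι)) fun w hw => ?_
  · intro w; rw [hall]; trivial
  -- a closed point `w` of `V(K)`
  have hzc : IsClosed ({K.subschemeι w} : Set X) := by
    simpa only [Set.image_singleton] using K.subschemeι.isClosedEmbedding.isClosedMap _ hw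
  have hzK : K.subschemeι w ∈ (K.support : Set X) := by
    rw [← range_subschemeι]; exact ⟨w, rfl⟩
  by_cases hz𝓢 : K.subschemeι w ∈ (𝓢.support : Set X)
  · obtain ⟨f, h', hf, hh, hnzd⟩ := h _ hzc hzK hz𝓢
    exact mem_cartierLocus_subschemeι_of_datum 𝓢 K w f h' hf hh hnzd
  · apply mem_cartierLocus_of_not_mem_support
    rw [support_comap]
    exact hz𝓢

end Summit.ResolutionOfSingularities.ResolutionOfSingularities.Cruxes.EquisingularLiftNat.Sections

end
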